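import Summits.QuantumFields.BalabanUV.Beta.WardBorderReflectionWallBlocks

/-!
# `BalabanUV.Beta.WardBorderReflectionWallJoint` — binder row D1, (L4): «D1-hRhW-SOCKET-CONSISTENCY» part 2e — THE ASSEMBLED WALL IDENTITY
# `W_Y(Bwall α) = G_α` AS A KERNEL EQUATION, and the JOINT hR∕hW border table from any hW border model

HONEST FRAMING (cell charter, verbatim): «discharging BetaPertH makes Balaban's UV stability UNCONDITIONAL — a real
constructive-QFT result; it is NOT the continuum limit and NOT the Clay problem.»  Neutral [folklore] assembly BY NAME of parts 2c∕2d (the four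
border blocks) with the trivial field–field ∕ multiplier–multiplier blocks, for the row-D1 owner's border contact `Bwall Lc cΛ γ α = bdB (wallD₀ …)`
(K-L2b `SecondOrderBorderModel`) against the hW END's level-0 Ward datum `F_Y(κ′,u′) := conjV ((−Lc⁸∕2) • vhSAt ρ_c κ′ u′) D_Y`,
`D_Y = diagK (½ • Σ_v legInd ρ_c (Lc•Y+v))` (leaf-06's `WardLocusRecursiveLetters` hBord0 at `j = 0`, `RB₀ := 0`, `stepScale 0 = 1`); then part 1
(`WardBorderReflection.ward_stepB`) and the owner's `stepB_solves_self∕other`, `actB_Bwall`, `comm_Bwall` give the JOINT table.  No statement of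
Bałaban's papers, no `[cite:]`, no `def`; instantiates NO binder of the β-function wall (0/4: hW, hR, D1Tel, D1Rep) — a joint model of two
SOCKETS is not the row's TRUE table; NOT hW, NOT hR, NOT D1, NOT `BetaPertH`, NOT continuum, NOT Clay.
HONEST DEPENDENCY: continuum YM on T⁴ ⇐ BetaPertH ∧ nine spine estimates (0/9 proved); BetaPertH ⇐ (D1) ∧ (D4) ∧ CAP+tail;
G-an2-4 gates asym, D1 and NE2/3/4.

CONTENT (`d = 3`, odd `Lc`, the END's `hγ`):
* §1 entry bookkeeping: `smul_sum_divV_apply`, `conjV_Spure0_inl_inr`∕`_inr_inl` (on the border `S₀ = (−Lc⁸∕2)•vhSAt`), the vanishing blocks.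
* §2 **`Bwall_ward_eq_defect`**: for every axis `α`, block `Y`, second bond `(κ′,u′)`, AS KERNELS:
  `Lc⁻⁴ • Σ_v divV (κ u ↦ Bwall Lc cΛ γ α κ u κ′ u′) (Lc•Y+v) = ε_α(κ′) • refK (Φ Lc α) (F_{sref α Y}(κ′, bref α κ′ u′)) − F_Y(κ′,u′)` — part 1's NECESSARY
  consistency identities HOLD for the wall: the hR border letter (K-I∕K-L) and the hW border Ward letter (W-B₀) are JOINTLY CONSISTENT at level 0.
* §3 **`joint_of_ward_model`**: if SOME bi-table `T` solves the exact hW border letter at level 0 (`Lc⁻⁴ • Σ_v divV (κ u ↦ 1 • T κ u κ′ u′) (Lc•Y+v) = F_Y(κ′,u′)`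
  for all `Y κ′ u′`), then the owner's four steps started at `T` give a table solving ALL FOUR reflection letters `actB_α T* − T* = Bwall α` AND the
  hW letter — JOINT hR∕hW border model ⟸ hW border model (the converse direction of Q-an2-g20-1 is part 1's `joint_consistency_necessary`).
Provenance: β sub-cell, D1 formalisation swarm, unit b2b-balaban-beta-d1-formalise-leaf-04 gen 4, 2026-08-20 (v1); no existing file touched.
-/

open Finset
open scoped BigOperators
open Literature.MathematicalPhysics.QuantumFieldTheory
open Literature.MathematicalPhysics.QuantumFieldTheory.Balaban1983to89
open Literature.MathematicalPhysics.QuantumFieldTheory.Balaban1983to89.Beta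
open ExpKernelCalculus (MKer)
open AffineAveraging (box toSite)
open AveragingContours (blk off)
open AveragingContoursRooted (ctr ctrOff)
open AveragingHessianKernels (packVH_inl_inr packVH_inr_inl packVH_inl_inl packVH_inr_inr)
open AveragingHessianKernelsRooted (vhSAt)
open KernelWard (divV)
open PolarizationSign (reflSign)
open KernelReflection (LegMap refK refK_apply)
open ResolventReflection (sref bref mref Φ Φ_r_inl Φ_r_inr Φ_s_inl Φ_s_inr)
open OneStepResolventKernel (Fib)
open StepJetData (wilsonA)
open BalabanStepJetsSucc (wE wVH)
open Summit.QuantumFields.BalabanUV.Beta.TameKernelCalculus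
open Summit.QuantumFields.BalabanUV.Beta.ChartConjugation (conjV)
open Summit.QuantumFields.BalabanUV.Beta.BorderedHessian (diagK diagK_apply conjV_diagK_apply stepScale)
open Summit.QuantumFields.BalabanUV.Beta.AveragingWardRootedStencils (legInd)
open Summit.QuantumFields.BalabanUV.Beta.WilsonReflectionContact (wilsonA_inl_inr wilsonA_inr_inl)
open Summit.QuantumFields.BalabanUV.Beta.SpineRooted (SpureRecAt SpureRecAt_zero_level)
open Summit.QuantumFields.BalabanUV.Beta.SecondOrderBorderGauge (actB)
open Summit.QuantumFields.BalabanUV.Beta.SecondOrderBorderCocycle (stepB stepB_solves_self stepB_solves_other bdB bdB_inl_inr bdB_inr_inl)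
open Summit.QuantumFields.BalabanUV.Beta.SecondOrderBorderModel (Bwall Bwall_inl_inl Bwall_inr_inr actB_Bwall comm_Bwall)
open Summit.QuantumFields.BalabanUV.Beta.WardBorderReflection (ward_stepB)
open Summit.QuantumFields.BalabanUV.Beta.WardBorderReflectionWall (wallD₀_ward_eq_defect_inl_inr)
open Summit.QuantumFields.BalabanUV.Beta.WardBorderReflectionWallBlocks (wallD₀_ward_eq_defect_inr_inl wallD₀_ward_eq_defect_inl_inr_axis
  wallD₀_ward_eq_defect_inr_inl_axis)

namespace Summit.QuantumFields.BalabanUV.Beta.WardBorderReflectionWallJoint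

noncomputable section

variable {Lc : ℕ} [NeZero Lc]

/-! ## §1 Entry bookkeeping -/

omit [NeZero Lc] in
/-- [folklore] Entries of the block Ward operator: `(s • Σ_v divV F (y v)) (e) = s · Σ_v Σ_κ (F κ (y v − e_κ) (e) − F κ (y v) (e))`. -/
theorem smul_sum_divV_apply (s : ℝ) (F : Fin 4 → (Fin 4 → ℤ) → MKer 4 (Fib 3)) (y : (Fin 4 → ℕ) → (Fin 4 → ℤ)) (x z : Fin 4 → ℤ)
    (a b : Fib 3) :
    (s • ∑ v ∈ box 4 Lc, divV F (y v)) x z a b =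
      s * ∑ v ∈ box 4 Lc, ∑ κ : Fin 4, (F κ (y v - B6BondElimination.unitVec κ) x z a b - F κ (y v) x z a b) := by
  simp only [Pi.smul_apply, Finset.sum_apply, KernelWard.divV, Pi.sub_apply, smul_eq_mul]

/-- [folklore] On the field–multiplier block `S₀ κ′ w = (−Lc⁸∕2) • vhSAt ρ_c κ′ w` (`wilsonA` is silent there), read through `conjV · (diagK g)`. -/
theorem conjV_Spure0_inl_inr (cΛ : ℝ) (κ' : Fin 4) (w : Fin 4 → ℤ) (g : (Fin 4 → ℤ) → Fib 3 → ℝ) (x z : Fin 4 → ℤ) (β m : Fin 4) :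
    conjV (SpureRecAt 3 Lc (toSite (ctrOff 4 Lc)) ((Lc : ℝ) ^ 4) (-((Lc : ℝ) ^ 8 / 2)) cΛ 0 κ' w) (diagK g) x z (Sum.inl β) (Sum.inr m) =
      conjV ((-((Lc : ℝ) ^ 8 / 2)) • vhSAt (toSite (ctrOff 4 Lc)) 3 Lc rfl κ' w) (diagK g) x z (Sum.inl β) (Sum.inr m) := by
  rw [conjV_diagK_apply, conjV_diagK_apply]
  simp only [SpureRecAt_zero_level, Pi.add_apply, Pi.smul_apply, smul_eq_mul, wilsonA_inl_inr, mul_zero, zero_add]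

/-- [folklore] The same on the multiplier–field block. -/
theorem conjV_Spure0_inr_inl (cΛ : ℝ) (κ' : Fin 4) (w : Fin 4 → ℤ) (g : (Fin 4 → ℤ) → Fib 3 → ℝ) (x z : Fin 4 → ℤ) (m β : Fin 4) :
    conjV (SpureRecAt 3 Lc (toSite (ctrOff 4 Lc)) ((Lc : ℝ) ^ 4) (-((Lc : ℝ) ^ 8 / 2)) cΛ 0 κ' w) (diagK g) x z (Sum.inr m) (Sum.inl β) =
      conjV ((-((Lc : ℝ) ^ 8 / 2)) • vhSAt (toSite (ctrOff 4 Lc)) 3 Lc rfl κ' w) (diagK g) x z (Sum.inr m) (Sum.inl β) := by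
  rw [conjV_diagK_apply, conjV_diagK_apply]
  simp only [SpureRecAt_zero_level, Pi.add_apply, Pi.smul_apply, smul_eq_mul, wilsonA_inr_inl, mul_zero, zero_add]

/-! ## §2 The assembled identity for `Bwall` against the END's Ward datum -/

/-- [folklore] **THE hR BORDER CONTACT SATISFIES THE hW CONSISTENCY IDENTITIES — AS A KERNEL EQUATION.**  For every reflection axis `α`, block `Y`
and second jet bond `(κ′, u′)`:
`Lc⁻⁴ • Σ_{v∈box 4 Lc} divV (κ u ↦ Bwall Lc cΛ γ α κ u κ′ u′) (Lc•Y + v) = ε_α(κ′) • refK (Φ Lc α) (F (sref α Y) κ′ (bref α κ′ u′)) − F Y κ′ u′`,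
`F Y κ′ u′ := conjV ((−Lc⁸∕2) • vhSAt ρ_c 3 Lc rfl κ′ u′) (diagK (½ • Σ_v legInd ρ_c (Lc•Y+v)))` — the identities that part 1's
`WardBorderReflection.joint_consistency_necessary` shows NECESSARY for any joint hR∕hW border table HOLD for the wall's level-0 data. -/
theorem Bwall_ward_eq_defect (hLc : Odd Lc) (cΛ : ℝ) (γ : ℕ → ℝ)
    (hγ : ∀ j, γ j = -((Lc : ℝ) ^ 8 / 2) * wVH 3 Lc j / (stepScale 3 Lc j * (Lc : ℝ) ^ 4)) (α : Fin 4)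
    (Y : Fin 4 → ℤ) (κ' : Fin 4) (u' : Fin 4 → ℤ) :
    (((Lc : ℝ) ^ 4)⁻¹) • ∑ v ∈ box 4 Lc, divV (fun κ u => Bwall Lc cΛ γ α κ u κ' u') ((Lc : ℤ) • Y + toSite v) =
      reflSign α κ' • refK (Φ (d := 3) Lc α)
          (conjV ((-((Lc : ℝ) ^ 8 / 2)) • vhSAt (toSite (ctrOff 4 Lc)) 3 Lc rfl κ' (bref α κ' u'))
            (diagK ((1 / 2 : ℝ) • ∑ v ∈ box 4 Lc, legInd (toSite (ctrOff 4 Lc)) ((Lc : ℤ) • sref α Y + toSite v)))) -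
        conjV ((-((Lc : ℝ) ^ 8 / 2)) • vhSAt (toSite (ctrOff 4 Lc)) 3 Lc rfl κ' u')
          (diagK ((1 / 2 : ℝ) • ∑ v ∈ box 4 Lc, legInd (toSite (ctrOff 4 Lc)) ((Lc : ℤ) • Y + toSite v))) := by
  funext x z a b
  -- the left-hand side through the entries of `Bwall = bdB wallD₀`
  have hLw : ∀ a b, (∀ κ u, Bwall Lc cΛ γ α κ u κ' u' x z a b = SecondOrderBorderGaugeWall.wallD₀ Lc cΛ γ α κ u κ' u' x z a b) →
      ((((Lc : ℝ) ^ 4)⁻¹) • ∑ v ∈ box 4 Lc, divV (fun κ u => Bwall Lc cΛ γ α κ u κ' u') ((Lc : ℤ) • Y + toSite v)) x z a b =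
        ((((Lc : ℝ) ^ 4)⁻¹) • ∑ v ∈ box 4 Lc, divV (fun κ u => SecondOrderBorderGaugeWall.wallD₀ Lc cΛ γ α κ u κ' u')
          ((Lc : ℤ) • Y + toSite v)) x z a b := by
    intro a b h
    rw [smul_sum_divV_apply, smul_sum_divV_apply]
    simp only [h]
  have hL0 : ∀ a b, (∀ κ u, Bwall Lc cΛ γ α κ u κ' u' x z a b = 0) →
      ((((Lc : ℝ) ^ 4)⁻¹) • ∑ v ∈ box 4 Lc, divV (fun κ u => Bwall Lc cΛ γ α κ u κ' u') ((Lc : ℤ) • Y + toSite v)) x z a b = 0 := by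
    intro a b h
    rw [smul_sum_divV_apply]
    simp only [h, sub_self, Finset.sum_const_zero, mul_zero]
  rcases a with β | m <;> rcases b with β' | m'
  · -- field–field: both sides vanish
    rw [hL0 _ _ (fun κ u => Bwall_inl_inl cΛ γ α κ u κ' u' x z β β')]
    rw [Pi.sub_apply, Pi.sub_apply, Pi.sub_apply, Pi.sub_apply, Pi.smul_apply, Pi.smul_apply, Pi.smul_apply, Pi.smul_apply, smul_eq_mul,
      refK_apply, conjV_diagK_apply, conjV_diagK_apply]
    simp only [Pi.smul_apply, smul_eq_mul, AveragingHessianKernelsRooted.vhSAt, packVH_inl_inl, mul_zero, zero_mul, sub_zero]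
  · -- field–multiplier
    rw [hLw _ _ (fun κ u => rfl)]
    by_cases hm : m' = α
    · subst hm
      rw [wallD₀_ward_eq_defect_inl_inr_axis hLc cΛ γ hγ _ Y κ' u' x z β]
      simp only [Pi.sub_apply, Pi.smul_apply, refK_apply, Φ_r_inl, Φ_r_inr, conjV_Spure0_inl_inr]
    · rw [wallD₀_ward_eq_defect_inl_inr hLc cΛ γ hγ α hm Y κ' u' x z β]
      simp only [Pi.sub_apply, Pi.smul_apply, refK_apply, Φ_r_inl, Φ_r_inr, conjV_Spure0_inl_inr]
  · -- multiplier–field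
    rw [hLw _ _ (fun κ u => rfl)]
    by_cases hm : m = α
    · subst hm
      rw [wallD₀_ward_eq_defect_inr_inl_axis hLc cΛ γ hγ _ Y κ' u' x z β']
      simp only [Pi.sub_apply, Pi.smul_apply, refK_apply, Φ_r_inl, Φ_r_inr, conjV_Spure0_inr_inl]
    · rw [wallD₀_ward_eq_defect_inr_inl hLc cΛ γ hγ α hm Y κ' u' x z β']
      simp only [Pi.sub_apply, Pi.smul_apply, refK_apply, Φ_r_inl, Φ_r_inr, conjV_Spure0_inr_inl]
  · -- multiplier–multiplier: both sides vanish
    rw [hL0 _ _ (fun κ u => Bwall_inr_inr cΛ γ α κ u κ' u' x z m m')]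
    rw [Pi.sub_apply, Pi.sub_apply, Pi.sub_apply, Pi.sub_apply, Pi.smul_apply, Pi.smul_apply, Pi.smul_apply, Pi.smul_apply, smul_eq_mul,
      refK_apply, conjV_diagK_apply, conjV_diagK_apply]
    simp only [Pi.smul_apply, smul_eq_mul, AveragingHessianKernelsRooted.vhSAt, packVH_inr_inr, mul_zero, zero_mul, sub_zero]

/-! ## §3 The joint border table from a Ward model -/

/-- [folklore] **JOINT hR∕hW BORDER TABLE FROM ANY hW BORDER MODEL.**  If a bi-table `T` solves the exact level-0 hW border Ward letter
(`RB₀ := 0`) for the datum `F`, then the row-D1 owner's four sequential steps started at `T`,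
`T* := stepB 3 (Bwall 3) (stepB 2 (Bwall 2) (stepB 1 (Bwall 1) (stepB 0 (Bwall 0) T)))`, solve ALL FOUR reflection letters `actB_α T* − T* = Bwall α`
AND the same Ward letter — by `Bwall_ward_eq_defect` (the consistency identities), part 1's `ward_stepB`, and the owner's `stepB_solves_self∕other`,
`actB_Bwall`, `comm_Bwall` BY NAME. -/
theorem joint_of_ward_model (hLc : Odd Lc) (cΛ : ℝ) (γ : ℕ → ℝ)
    (hγ : ∀ j, γ j = -((Lc : ℝ) ^ 8 / 2) * wVH 3 Lc j / (stepScale 3 Lc j * (Lc : ℝ) ^ 4))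
    {T : Fin 4 → (Fin 4 → ℤ) → Fin 4 → (Fin 4 → ℤ) → MKer 4 (Fib 3)}
    (hW : ∀ (Y : Fin 4 → ℤ) (κ' : Fin 4) (u' : Fin 4 → ℤ),
      (((Lc : ℝ) ^ 4)⁻¹) • ∑ v ∈ box 4 Lc, divV (fun κ u => (1 : ℝ) • T κ u κ' u') ((Lc : ℤ) • Y + toSite v) =
        conjV ((-((Lc : ℝ) ^ 8 / 2)) • vhSAt (toSite (ctrOff 4 Lc)) 3 Lc rfl κ' u')
          (diagK ((1 / 2 : ℝ) • ∑ v ∈ box 4 Lc, legInd (toSite (ctrOff 4 Lc)) ((Lc : ℤ) • Y + toSite v)))) :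
    let T₄ := stepB Lc 3 (Bwall Lc cΛ γ 3) (stepB Lc 2 (Bwall Lc cΛ γ 2) (stepB Lc 1 (Bwall Lc cΛ γ 1) (stepB Lc 0 (Bwall Lc cΛ γ 0) T)))
    (∀ α : Fin 4, actB Lc α T₄ - T₄ = Bwall Lc cΛ γ α) ∧
      (∀ (Y : Fin 4 → ℤ) (κ' : Fin 4) (u' : Fin 4 → ℤ),
        (((Lc : ℝ) ^ 4)⁻¹) • ∑ v ∈ box 4 Lc, divV (fun κ u => (1 : ℝ) • T₄ κ u κ' u') ((Lc : ℤ) • Y + toSite v) =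
          conjV ((-((Lc : ℝ) ^ 8 / 2)) • vhSAt (toSite (ctrOff 4 Lc)) 3 Lc rfl κ' u')
            (diagK ((1 / 2 : ℝ) • ∑ v ∈ box 4 Lc, legInd (toSite (ctrOff 4 Lc)) ((Lc : ℤ) • Y + toSite v)))) := by
  intro T₄
  have hA := actB_Bwall hLc cΛ γ hγ
  have hC := comm_Bwall hLc cΛ γ hγ
  -- the consistency identities in the `c = 1` spelling of part 1
  have hId : ∀ (α : Fin 4) (Y : Fin 4 → ℤ) (κ' : Fin 4) (u' : Fin 4 → ℤ),
      (((Lc : ℝ) ^ 4)⁻¹) • ∑ v ∈ box 4 Lc, divV (fun κ u => (1 : ℝ) • Bwall Lc cΛ γ α κ u κ' u') ((Lc : ℤ) • Y + toSite v) =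
        reflSign α κ' • refK (Φ (d := 3) Lc α)
            ((fun Y κ' u' => conjV ((-((Lc : ℝ) ^ 8 / 2)) • vhSAt (toSite (ctrOff 4 Lc)) 3 Lc rfl κ' u')
              (diagK ((1 / 2 : ℝ) • ∑ v ∈ box 4 Lc, legInd (toSite (ctrOff 4 Lc)) ((Lc : ℤ) • Y + toSite v)))) (sref α Y) κ' (bref α κ' u')) -
          (fun Y κ' u' => conjV ((-((Lc : ℝ) ^ 8 / 2)) • vhSAt (toSite (ctrOff 4 Lc)) 3 Lc rfl κ' u')
            (diagK ((1 / 2 : ℝ) • ∑ v ∈ box 4 Lc, legInd (toSite (ctrOff 4 Lc)) ((Lc : ℤ) • Y + toSite v)))) Y κ' u' := by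
    intro α Y κ' u'
    have e : (fun κ u => (1 : ℝ) • Bwall Lc cΛ γ α κ u κ' u') = fun κ u => Bwall Lc cΛ γ α κ u κ' u' := by
      funext κ u; rw [one_smul]
    rw [e]
    exact Bwall_ward_eq_defect hLc cΛ γ hγ α Y κ' u'
  have hW' : ∀ (Y : Fin 4 → ℤ) (κ' : Fin 4) (u' : Fin 4 → ℤ),
      (((Lc : ℝ) ^ 4)⁻¹) • ∑ v ∈ box 4 Lc, divV (fun κ u => (1 : ℝ) • T κ u κ' u') ((Lc : ℤ) • Y + toSite v) =
        (fun Y κ' u' => conjV ((-((Lc : ℝ) ^ 8 / 2)) • vhSAt (toSite (ctrOff 4 Lc)) 3 Lc rfl κ' u')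
          (diagK ((1 / 2 : ℝ) • ∑ v ∈ box 4 Lc, legInd (toSite (ctrOff 4 Lc)) ((Lc : ℤ) • Y + toSite v)))) Y κ' u' := hW
  -- Ward letter through the four steps
  have w1 := fun Y κ' u' => ward_stepB (N := Lc) hW' (hId 0) Y κ' u'
  have w2 := fun Y κ' u' => ward_stepB (N := Lc) w1 (hId 1) Y κ' u'
  have w3 := fun Y κ' u' => ward_stepB (N := Lc) w2 (hId 2) Y κ' u'
  have w4 := fun Y κ' u' => ward_stepB (N := Lc) w3 (hId 3) Y κ' u'
  -- reflection letters through the four steps (the pattern of `Twall_solves`)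
  have s10 : actB Lc 0 (stepB Lc 0 (Bwall Lc cΛ γ 0) T) - stepB Lc 0 (Bwall Lc cΛ γ 0) T = Bwall Lc cΛ γ 0 := stepB_solves_self (hA 0) T
  have s21 := stepB_solves_self (hA 1) (stepB Lc 0 (Bwall Lc cΛ γ 0) T)
  have s20 := stepB_solves_other s10 (hC 1 0)
  have s32 := stepB_solves_self (hA 2) (stepB Lc 1 (Bwall Lc cΛ γ 1) (stepB Lc 0 (Bwall Lc cΛ γ 0) T))
  have s31 := stepB_solves_other s21 (hC 2 1)
  have s30 := stepB_solves_other s20 (hC 2 0)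
  have s43 := stepB_solves_self (hA 3) (stepB Lc 2 (Bwall Lc cΛ γ 2) (stepB Lc 1 (Bwall Lc cΛ γ 1) (stepB Lc 0 (Bwall Lc cΛ γ 0) T)))
  have s42 := stepB_solves_other s32 (hC 3 2)
  have s41 := stepB_solves_other s31 (hC 3 1)
  have s40 := stepB_solves_other s30 (hC 3 0)
  refine ⟨fun α => ?_, w4⟩
  fin_cases α
  · exact s40
  · exact s41
  · exact s42
  · exact s43

end

end Summit.QuantumFields.BalabanUV.Beta.WardBorderReflectionWallJoint
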